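import Summits.QuantumFields.YangMills.Theorems.BalabanUVNodesN12BjRootChainsGraded
import HarnessLib

/-!
# BalabanUVNodes ∕ N12 — THE ROOT-TRANSPORTER LETTER `hT` AT THE RECORD's `𝐁_k(Z)`, inhabited from the (G-c) root chains: for every fine bond inside `Ω₁(Z)` a fine word from `root b₋` to
# `root b₊` of length `≤ m·L^k` whose `U₀`-transport is within `m·θ_k` of a group element within `m·δ₁` of `1`, `m = 3·d·(L−1)∕2 + 5` — modulo dag-n12-w2's segment corr-factor letter and
# the member-average letter (the second layer of dag-n12-w6's `B15Prop1InteriorLetterCorridor`, [Balaban1985Variational] (16)–(18) between the points of `𝔅_k`)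

Cell `pub-ymgap` (HUMAN RULINGS D-0062 ∕ D-0149), WIDTH SEAT `pub-ymgap-dag-n12-w3` g4 (node N12 = [B15]; key K1⁹ `stmt-QuantumFields-27364` (KEY MAP v2), `--kind proof --supports … --as
helper`; count-neutral).  THEOREMS ONLY (0 `def`, 0 `instance`, 0 `sorry`); consumed BY NAME: this lineage's `N12BjRootChains.exists_rootChain_Bj` ∕ `exists_chain_root_centre` ∕
`exists_chain_centre_centre` and `N12BlockChains.length_flatten_le_of_forall_le`, dag-n12-w6's `T4ForestGaugeCorridorBound.dist1_holAt_chain_mul_prod_inv_le` ∕ `dist1_prod_le_sum` ∕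
`dist1_segRev_mul_iter_blockAvg_le` (p628442 ∕ p630939), dag-n12-w2's `BlockAveragingTowerStraightTransportLocal.dist1_straight_mul_inv_iter_le_local` (p627202).

WHY.  dag-n12-w6's `B15Prop1InteriorLetterCorridor` (first layer) reduces the corridor half `hL_corridor` of the interior letter of the localised gauge letter (σ)_N to a ROOT-TRANSPORTER
LETTER `hT : ∀ b, b₋ ∈ Ω₁ → b₊ ∈ Ω₁ → root b₋ ≠ root b₊ → ∃ Ω g, walkEnd (root b₋) Ω = root b₊ ∧ |Ω| ≤ ℓT ∧ dist1 (𝒰_{U₀}(walk (root b₋) Ω)·g⁻¹) ≤ eT ∧ dist1 g ≤ dG`.  THIS FILE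
inhabits `hT` at the record's `𝐁_k(Z)` — capped (`rootTransporter_Bj`, budgets at level `k`) and GRADED by the level of the bond (`rootTransporter_Bj_graded`, budgets at level `J + 1`) — (and the hub letters (H1)∕(H2) of `T4RootTransporterHubs`, hub = centre of the `Γ`-level block): the word is the concatenation of the straight segments
of a ROOT CHAIN of member bonds (`N12BjRootChains`), `g` the ordered product of the block averages `M^{i}(U₀)(c)^{±1}` along it, the transport error the sum of dag-n12-w2's `θ_i` per
link (forward `dist1_straight_mul_inv_iter_le_local`, backward `dist1_segRev_mul_iter_blockAvg_le`), `dist1 g ≤ Σ dist1 M(c)`.  DISPLAYED (hypotheses, dag-n12-w2's currency VERBATIM):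
the segment corr-factor letter `hκ` (the correction factors of [Balaban1987RG1] (0.4) met on the segment of every member bond, `κ_i + L·θ_i ≤ θ_{i+1}`, `0 ≤ θ_0`, `θ_i ≤ θ_k`) and the
member-average letter `dist1 (M^i(U₀)(c)) ≤ δ₁` on the members of `𝐁_k(Z)` (at the constrained minimiser: the datum side, `B15Prop1MinimiserTowerAxialGauge` §5).

HONEST FRAMING.  Lattice∕group bookkeeping by name; no estimate of Bałaban's asserted; the two letters, the forest and the minimiser stay DISPLAYED; N12 NOT discharged; K1⁹ NOT closed;
counts unmoved (typed 28∕28 · discharged 5∕27); one finite 𝕋⁴ programme at fixed ε — R4 closes the conditional rung `BalabanLadder.UV` only; the Yang–Mills mass gap (Clay) is NOT proved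
by any of this; nothing continuum ∕ ℝ⁴ ∕ OS.
-/

noncomputable section

namespace Summit.QuantumFields.YangMills.BalabanUVNodes.N12RootTransporterBj

open scoped BigOperators
open Literature.MathematicalPhysics.QuantumFieldTheory.Balaban1983to89
open T4Continuum BlockAveraging
open B15DeterminingSets
open B5Eq118OneStroke (iterBlockOf)
open B14.Eq213MaximalDomains (side)
open B14.Eq213DetSet (Bj Bj_zero maxDomT)
open T4ForestGaugeCorridorBound (dist1_holAt_chain_mul_prod_inv_le dist1_prod_le_sum dist1_segRev_mul_iter_blockAvg_le)
open BlockAveragingTowerStraightTransportLocal (dist1_straight_mul_inv_iter_le_local)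
open Summit.QuantumFields.YangMills.BalabanUVNodes.N12FlatHndRecordLetters (hcov_Bj)
open Summit.QuantumFields.YangMills.BalabanUVNodes.N12BlockChains (length_flatten_le_of_forall_le)
open Summit.QuantumFields.YangMills.BalabanUVNodes.N12BjRootChains (exists_rootChain_Bj exists_chain_root_centre exists_chain_centre_centre)
open Summit.QuantumFields.YangMills.BalabanUVNodes.N12BjRootChainsGraded (exists_rootChain_Bj_graded)

variable {P : Params} {G : Type*} [GaugeGroup G]

/-! ## §1 A chain of member links gives a transporter datum -/

section Links

/-- The tower budgets are MONOTONE when the correction budgets are nonnegative: `0 ≤ θ₀`, `0 ≤ κ_i`, `κ_i + L·θ_i ≤ θ_{i+1}` (`L ≥ 1`) give `0 ≤ θ_i ≤ θ_k` for `i ≤ k` — the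
hypothesis `hθk` below in dag-n12-w2's currency. [cite: Balaban1987RG1, (0.4) and (0.11) p.253 (bookkeeping)] -/
theorem theta_mono_of_nonneg (κ θ : ℕ → ℝ) (hθ0 : 0 ≤ θ 0) (hκ0 : ∀ i, 0 ≤ κ i) (hθ : ∀ i, κ i + P.L * θ i ≤ θ (i + 1)) :
    ∀ {i k : ℕ}, i ≤ k → 0 ≤ θ i ∧ θ i ≤ θ k := by
  have hL : (1 : ℝ) ≤ P.L := by exact_mod_cast P.L_pos
  have hnn : ∀ i, 0 ≤ θ i := fun i => by
    induction i with
    | zero => exact hθ0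
    | succ n ih => exact le_trans (by nlinarith [hκ0 n, ih]) (hθ n)
  have hstep : ∀ i, θ i ≤ θ (i + 1) := fun i => by nlinarith [hκ0 i, hnn i, hθ i]
  intro i k hik
  refine ⟨hnn i, ?_⟩
  induction hik with
  | refl => exact le_rfl
  | step _ ih => exact ih.trans (hstep _)

/-- ★★ **A CHAIN OF MEMBER LINKS IS A TRANSPORTER DATUM.**  `ℰ` any small-loop average, `U` a fine configuration, `𝔹` a determining set; dag-n12-w2's tower budgets `κ`, `θ` (`0 ≤ θ₀`,
`κ_i + L·θ_i ≤ θ_{i+1}`, `θ_i ≤ θ_N` for `i ≤ N`, `N` a LEVEL CAP of the links); DISPLAYED: the segment corr-factor letter on every member bond of level `≤ k` (the hypothesis `hκ` of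
`BlockAveragingTowerStraightTransportLocal.dist1_straight_mul_inv_iter_le_local`, verbatim) and the member-average letter `dist1 (M^i(U)(c)) ≤ δ₁`.  THEN a list of links `⟨i, c, ±⟩`, members
of level `≤ k`, whose segment words are consecutive from `r` (the `pre ++ l :: post` addressing), has: the transport of `U` along the concatenated segments within `(#links)·θ_k` of the
ordered product `g` of the `M^{i}(U)(c)^{±1}` (`θ_N` for the cap `N`), `dist1 g ≤ (#links)·δ₁`, and total length `≤ (#links)·L^N`.
[cite: Balaban1985Variational, (16)–(18) p.280; Balaban1985Averaging, (19)–(20) p.21; Balaban1987RG1, (0.4) p.253] -/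
theorem transporter_of_links (ℰ : LoopAverage G) (U : GaugeField P 0 G) (κ θ : ℕ → ℝ) (hθ0 : 0 ≤ θ 0) (hθ : ∀ i, κ i + P.L * θ i ≤ θ (i + 1))
    {k N : ℕ} (hθN : ∀ i ≤ N, θ i ≤ θ N) (𝔹 : DetSet P)
    (hκ : ∀ i ≤ k, ∀ c ∈ bondsOf (𝔹 i), ∀ i' < i, ∀ c' : PBond P (i' + 1), c'.dir = c.dir →
      (∃ t < P.L ^ i, embIter (i' + 1) c'.src = (fun z : Site P 0 => z.shift c.dir)^[t] (embIter i c.src)) →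
      dist1 (corr ℰ (Averaging.iter (fun i => blockAvg (P := P) (j := i) ℰ) i' U) c') ≤ κ i')
    {δ₁ : ℝ} (hδ₁ : ∀ i ≤ k, ∀ c ∈ bondsOf (𝔹 i), dist1 (Averaging.iter (fun i => blockAvg (P := P) (j := i) ℰ) i U c) ≤ δ₁)
    (r : Site P 0) (links : List ((m : ℕ) × (PBond P m × Bool)))
    (hmem : ∀ l ∈ links, l.1 ≤ k ∧ l.2.1 ∈ bondsOf (𝔹 l.1)) (hmemN : ∀ l ∈ links, l.1 ≤ N)
    (hcons : ∀ (pre post : List ((m : ℕ) × (PBond P m × Bool))) (l : (m : ℕ) × (PBond P m × Bool)), links = pre ++ l :: post →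
      (l.2.2 = true → walkEnd r (pre.map fun l => List.replicate (P.L ^ l.1) (l.2.1.dir, l.2.2)).flatten = embIter l.1 l.2.1.src) ∧
      (l.2.2 = false → walkEnd r (pre.map fun l => List.replicate (P.L ^ l.1) (l.2.1.dir, l.2.2)).flatten = embIter l.1 l.2.1.tgt)) :
    ∃ g : G, dist1 (holAt U (walk r (links.map fun l => List.replicate (P.L ^ l.1) (l.2.1.dir, l.2.2)).flatten) * g⁻¹) ≤ links.length * θ N ∧
      dist1 g ≤ links.length * δ₁ ∧
      ((links.map fun l => List.replicate (P.L ^ l.1) (l.2.1.dir, l.2.2)).flatten).length ≤ links.length * P.L ^ N := by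
  classical
  -- the links as (word, element, budget) triples
  set M : (m : ℕ) × (PBond P m × Bool) → G := fun l => Averaging.iter (fun i => blockAvg (P := P) (j := i) ℰ) l.1 U l.2.1 with hM
  set τ : (m : ℕ) × (PBond P m × Bool) → List (Letter P.d) × G × ℝ :=
    fun l => (List.replicate (P.L ^ l.1) (l.2.1.dir, l.2.2), (if l.2.2 then M l else (M l)⁻¹), θ l.1) with hτ
  have hfst : (links.map τ).map Prod.fst = links.map fun l => List.replicate (P.L ^ l.1) (l.2.1.dir, l.2.2) := by
    rw [List.map_map]; rfl
  -- the per-link transporter letter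
  have hlinks : ∀ (pre post : List (List (Letter P.d) × G × ℝ)) (link : List (Letter P.d) × G × ℝ), links.map τ = pre ++ link :: post →
      dist1 (holAt U (walk (walkEnd r (pre.map Prod.fst).flatten) link.1) * (link.2.1)⁻¹) ≤ link.2.2 := by
    intro pre post link h
    obtain ⟨pre₀, rest, hsplit, hpre, hrest⟩ := List.map_eq_append_iff.mp h
    obtain ⟨l₀, post₀, hrest', hl, -⟩ := List.map_eq_cons_iff.mp hrest
    subst hl
    rw [hrest'] at hsplit
    obtain ⟨hl₀k, hl₀mem⟩ := hmem l₀ (by rw [hsplit]; simp)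
    have hpre' : (pre.map Prod.fst).flatten = (pre₀.map fun l => List.replicate (P.L ^ l.1) (l.2.1.dir, l.2.2)).flatten := by
      rw [← hpre, List.map_map]; rfl
    have hst := hcons pre₀ post₀ l₀ hsplit
    have hκ₀ := hκ l₀.1 hl₀k l₀.2.1 hl₀mem
    rw [hpre']
    cases h2 : l₀.2.2
    · -- backward: from `ι c₊` along `(−e_dir)^{L^i}` versus `M(c)⁻¹`
      rw [hst.2 h2]
      have hseg : (τ l₀).1 = wordRev (List.replicate (P.L ^ l₀.1) (l₀.2.1.dir, true)) := by
        show List.replicate (P.L ^ l₀.1) (l₀.2.1.dir, l₀.2.2) = _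
        unfold wordRev
        rw [List.map_replicate, List.reverse_replicate, h2]
        rfl
      have hg : (τ l₀).2.1 = (M l₀)⁻¹ := by show (if l₀.2.2 then M l₀ else (M l₀)⁻¹) = _; rw [h2]; rfl
      rw [hseg, hg]
      exact dist1_segRev_mul_iter_blockAvg_le ℰ U κ θ hθ0 hθ l₀.1 l₀.2.1 hκ₀
    · -- forward: from `ι c₋` along `(+e_dir)^{L^i}` versus `M(c)`
      rw [hst.1 h2]
      have hseg : (τ l₀).1 = List.replicate (P.L ^ l₀.1) (l₀.2.1.dir, true) := by
        show List.replicate (P.L ^ l₀.1) (l₀.2.1.dir, l₀.2.2) = _; rw [h2]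
      have hg : (τ l₀).2.1 = M l₀ := by show (if l₀.2.2 then M l₀ else (M l₀)⁻¹) = _; rw [h2]; rfl
      rw [hseg, hg]
      exact dist1_straight_mul_inv_iter_le_local ℰ U κ θ hθ0 hθ l₀.1 l₀.2.1 hκ₀
  have hchain := dist1_holAt_chain_mul_prod_inv_le U (links.map τ) r hlinks
  rw [hfst] at hchain
  refine ⟨((links.map τ).map fun l => l.2.1).prod, hchain.trans ?_, (dist1_prod_le_sum _).trans ?_, ?_⟩
  · -- `Σ θ_{i_l} ≤ (#links)·θ_N`
    have h : ∀ x ∈ (links.map τ).map (fun l => l.2.2), x ≤ θ N := by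
      intro x hx
      obtain ⟨l, hl, rfl⟩ := List.mem_map.mp hx
      obtain ⟨l₀, hl₀, rfl⟩ := List.mem_map.mp hl
      exact hθN l₀.1 (hmemN l₀ hl₀)
    have := List.sum_le_card_nsmul _ (θ N) h
    rw [List.length_map, List.length_map, nsmul_eq_mul] at this
    exact this
  · -- `Σ dist1 g_l ≤ (#links)·δ₁`
    have h : ∀ x ∈ ((links.map τ).map fun l => l.2.1).map dist1, x ≤ δ₁ := by
      intro x hx
      obtain ⟨g, hg, rfl⟩ := List.mem_map.mp hx
      obtain ⟨l, hl, rfl⟩ := List.mem_map.mp hg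
      obtain ⟨l₀, hl₀, rfl⟩ := List.mem_map.mp hl
      have hd := hδ₁ l₀.1 (hmem l₀ hl₀).1 l₀.2.1 (hmem l₀ hl₀).2
      show dist1 (if l₀.2.2 then M l₀ else (M l₀)⁻¹) ≤ δ₁
      split_ifs
      · exact hd
      · rw [GaugeGroup.dist1_inv]; exact hd
    have := List.sum_le_card_nsmul _ δ₁ h
    rw [List.length_map, List.length_map, List.length_map, nsmul_eq_mul] at this
    exact this
  · -- total length
    refine length_flatten_le_of_forall_le _ links fun l hl => ?_
    rw [List.length_replicate]
    exact Nat.pow_le_pow_right P.L_pos (hmemN l hl)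

end Links

/-! ## §2 At the record: the root-transporter letter and the hub letters of `𝐁_k(Z)` -/

section Record

variable {M₁ k : ℕ} {Z : Set (Site P 0)}

/-- ★★★ **THE ROOT-TRANSPORTER LETTER `hT` OF `B15Prop1InteriorLetterCorridor` AT THE RECORD's `𝐁_k(Z)`** (`1 ≤ k ≤ m + K`, `M₁ ≥ 2`, cover divisibility; `root` any root map with p635000's
(CENTRE) clause — the rooted tower forest of the record; any `GaugeGroup`, any small-loop average `ℰ`, any fine configuration `U`).  DISPLAYED, in dag-n12-w2's currency: the tower budgets
`κ, θ` with the segment corr-factor letter on the members of `𝐁_k(Z)` and the member-average letter `dist1 (M^i(U)(c)) ≤ δ₁`.  THEN for EVERY fine bond `b` with both ends in `Ω₁(Z)` (and,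
`root b₋ ≠ root b₊`) there are a fine word `Ω` from `root b₋` to `root b₊` of length `≤ m·L^k` and `g` with `dist1 (𝒰_U(walk (root b₋) Ω)·g⁻¹) ≤ m·θ_k`, `dist1 g ≤ m·δ₁`,
`m = 3·d·(L−1)∕2 + 5` — the segments of the root chain `N12BjRootChains.exists_rootChain_Bj` and the ordered product of the averages along it.
[cite: Balaban1985Variational, (3)–(4) p.278, (16)–(18) p.280; Balaban1985RegularSpaces, (1.19) p.79; Balaban1985Averaging, (19)–(20) p.21; Balaban1988Convergent, (2.13) pp.256–257] -/
theorem rootTransporter_Bj (hk : k ≤ P.m + P.K) (hk1 : 1 ≤ k) (hM2 : 2 ≤ M₁) (hdiv : side P.L M₁ k ∣ P.sitesPerDir 0) (root : Site P 0 → Site P 0)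
    (hcentre : ∀ (z : Site P 0) (J : ℕ), iterBlockOf J z ∈ (Bj M₁ Z k : DetSet P) J →
      ((1 ≤ J ∧ ∃ c ∈ bondsOf ((Bj M₁ Z k : DetSet P) (J - 1)), (iterBlockOf (J - 1) z = c.src ∨ iterBlockOf (J - 1) z = c.tgt)) ∧
          root z = embIter (J - 1) (iterBlockOf (J - 1) z)) ∨
      (¬ (1 ≤ J ∧ ∃ c ∈ bondsOf ((Bj M₁ Z k : DetSet P) (J - 1)), (iterBlockOf (J - 1) z = c.src ∨ iterBlockOf (J - 1) z = c.tgt)) ∧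
          root z = embIter J (iterBlockOf J z)))
    (ℰ : LoopAverage G) (U : GaugeField P 0 G) (κ θ : ℕ → ℝ) (hθ0 : 0 ≤ θ 0) (hθ : ∀ i, κ i + P.L * θ i ≤ θ (i + 1)) (hθk : ∀ i ≤ k, θ i ≤ θ k)
    (hκ : ∀ i ≤ k, ∀ c ∈ bondsOf ((Bj M₁ Z k : DetSet P) i), ∀ i' < i, ∀ c' : PBond P (i' + 1), c'.dir = c.dir →
      (∃ t < P.L ^ i, embIter (i' + 1) c'.src = (fun z : Site P 0 => z.shift c.dir)^[t] (embIter i c.src)) →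
      dist1 (corr ℰ (Averaging.iter (fun i => blockAvg (P := P) (j := i) ℰ) i' U) c') ≤ κ i')
    {δ₁ : ℝ} (hδ₁ : ∀ i ≤ k, ∀ c ∈ bondsOf ((Bj M₁ Z k : DetSet P) i), dist1 (Averaging.iter (fun i => blockAvg (P := P) (j := i) ℰ) i U c) ≤ δ₁) :
    ∀ b : PBond P 0, b.src ∈ maxDomT M₁ Z 1 → b.tgt ∈ maxDomT M₁ Z 1 → root b.src ≠ root b.tgt →
      ∃ (Ωw : List (Letter P.d)) (g : G), walkEnd (root b.src) Ωw = root b.tgt ∧ Ωw.length ≤ (3 * (P.d * ((P.L - 1) / 2)) + 5) * P.L ^ k ∧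
        dist1 (holAt U (walk (root b.src) Ωw) * g⁻¹) ≤ ((3 * (P.d * ((P.L - 1) / 2)) + 5 : ℕ) : ℝ) * θ k ∧
        dist1 g ≤ ((3 * (P.d * ((P.L - 1) / 2)) + 5 : ℕ) : ℝ) * δ₁ := by
  intro b hbs hbt hne
  obtain ⟨links, hlen, hmem, hend, hcons⟩ := exists_rootChain_Bj hk hk1 hM2 hdiv root hcentre b hbs hbt
  obtain ⟨g, hH, hg, hl⟩ := transporter_of_links ℰ U κ θ hθ0 hθ hθk (Bj M₁ Z k) hκ hδ₁ (root b.src) links hmem (fun l hl => (hmem l hl).1) hcons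
  have hθk0 : 0 ≤ θ k := hθ0.trans (hθk 0 (Nat.zero_le k))
  have hδ0 : (0 : ℝ) ≤ δ₁ ∨ links = [] := by
    rcases links with _ | ⟨l, ls⟩
    · exact Or.inr rfl
    · exact Or.inl ((GaugeGroup.dist1_nonneg _).trans (hδ₁ l.1 (hmem l (by simp)).1 l.2.1 (hmem l (by simp)).2))
  have hlenR : (links.length : ℝ) ≤ ((3 * (P.d * ((P.L - 1) / 2)) + 5 : ℕ) : ℝ) := by exact_mod_cast hlen
  refine ⟨_, g, hend, hl.trans (Nat.mul_le_mul_right _ hlen), hH.trans (mul_le_mul_of_nonneg_right hlenR hθk0), hg.trans ?_⟩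
  rcases hδ0 with h0 | hnil
  · exact mul_le_mul_of_nonneg_right hlenR h0
  · -- an empty chain would mean `root b₋ = root b₊`
    subst hnil
    simp only [List.map_nil, List.flatten_nil, walkEnd] at hend
    exact absurd hend hne

/-- ★★★ **THE ROOT-TRANSPORTER LETTER, GRADED BY THE LEVEL OF THE BOND** (dag-n12-w6's LOCATED-GRADING ∕ dag-n12-c's LOCATED-PLAQ: per-bond budgets).  Same data as `rootTransporter_Bj`, `θ`
MONOTONE; for a fine bond `b` inside `Ω₁(Z)` whose source has `Γ`-level `J` (`B^J b₋ ∈ 𝐁_k(Z)_J`) the word runs at levels `≤ min(J + 1, k)` (`N12BjRootChainsGraded.exists_rootChain_Bj_graded`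
+ membership), so `|Ω| ≤ m·L^{min(J+1,k)}`, `dist1 (𝒰_U(walk (root b₋) Ω)·g⁻¹) ≤ m·θ_{min(J+1,k)}`, `dist1 g ≤ m·δ₁`, `m = 3·d·(L−1)∕2 + 5` — the per-bond transporter budget `ℓb b := m·L^{min(J(b)+1,k)}`.
[cite: Balaban1985Variational, (16)–(18) p.280; Balaban1985RegularSpaces, (1.7) p.77, (1.19) p.79; Balaban1985Averaging, (19)–(20) p.21; Balaban1988Convergent, (2.13) pp.256–257] -/
theorem rootTransporter_Bj_graded (hk : k ≤ P.m + P.K) (hk1 : 1 ≤ k) (hM2 : 2 ≤ M₁) (hdiv : side P.L M₁ k ∣ P.sitesPerDir 0) (root : Site P 0 → Site P 0)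
    (hcentre : ∀ (z : Site P 0) (J : ℕ), iterBlockOf J z ∈ (Bj M₁ Z k : DetSet P) J →
      ((1 ≤ J ∧ ∃ c ∈ bondsOf ((Bj M₁ Z k : DetSet P) (J - 1)), (iterBlockOf (J - 1) z = c.src ∨ iterBlockOf (J - 1) z = c.tgt)) ∧
          root z = embIter (J - 1) (iterBlockOf (J - 1) z)) ∨
      (¬ (1 ≤ J ∧ ∃ c ∈ bondsOf ((Bj M₁ Z k : DetSet P) (J - 1)), (iterBlockOf (J - 1) z = c.src ∨ iterBlockOf (J - 1) z = c.tgt)) ∧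
          root z = embIter J (iterBlockOf J z)))
    (ℰ : LoopAverage G) (U : GaugeField P 0 G) (κ θ : ℕ → ℝ) (hθ0 : 0 ≤ θ 0) (hθ : ∀ i, κ i + P.L * θ i ≤ θ (i + 1)) (hθmono : ∀ i j, i ≤ j → θ i ≤ θ j)
    (hκ : ∀ i ≤ k, ∀ c ∈ bondsOf ((Bj M₁ Z k : DetSet P) i), ∀ i' < i, ∀ c' : PBond P (i' + 1), c'.dir = c.dir →
      (∃ t < P.L ^ i, embIter (i' + 1) c'.src = (fun z : Site P 0 => z.shift c.dir)^[t] (embIter i c.src)) →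
      dist1 (corr ℰ (Averaging.iter (fun i => blockAvg (P := P) (j := i) ℰ) i' U) c') ≤ κ i')
    {δ₁ : ℝ} (hδ₁ : ∀ i ≤ k, ∀ c ∈ bondsOf ((Bj M₁ Z k : DetSet P) i), dist1 (Averaging.iter (fun i => blockAvg (P := P) (j := i) ℰ) i U c) ≤ δ₁) :
    ∀ b : PBond P 0, b.src ∈ maxDomT M₁ Z 1 → b.tgt ∈ maxDomT M₁ Z 1 → root b.src ≠ root b.tgt →
      ∀ J : ℕ, iterBlockOf J b.src ∈ (Bj M₁ Z k : DetSet P) J →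
      ∃ (Ωw : List (Letter P.d)) (g : G), walkEnd (root b.src) Ωw = root b.tgt ∧ Ωw.length ≤ (3 * (P.d * ((P.L - 1) / 2)) + 5) * P.L ^ min (J + 1) k ∧
        dist1 (holAt U (walk (root b.src) Ωw) * g⁻¹) ≤ ((3 * (P.d * ((P.L - 1) / 2)) + 5 : ℕ) : ℝ) * θ (min (J + 1) k) ∧
        dist1 g ≤ ((3 * (P.d * ((P.L - 1) / 2)) + 5 : ℕ) : ℝ) * δ₁ := by
  intro b hbs hbt hne J hJ
  have hM : 1 ≤ M₁ := by omega
  obtain ⟨J', -, hJ'⟩ := hcov_Bj hM hk1 hk hdiv (Z := Z) b.tgt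
  obtain ⟨links, hlen, hmem, hgrade, hend, hcons⟩ := exists_rootChain_Bj_graded hk hk1 hM2 hdiv root hcentre b hbs hbt hJ hJ'
  obtain ⟨g, hH, hg, hl⟩ := transporter_of_links ℰ U κ θ hθ0 hθ (fun i hi => hθmono i _ hi) (Bj M₁ Z k) hκ hδ₁ (root b.src) links hmem
    (fun l hl => le_min (hgrade l hl).1 (hmem l hl).1) hcons
  have hθJ0 : 0 ≤ θ (min (J + 1) k) := hθ0.trans (hθmono 0 _ (Nat.zero_le _))
  have hδ0 : (0 : ℝ) ≤ δ₁ ∨ links = [] := by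
    rcases links with _ | ⟨l, ls⟩
    · exact Or.inr rfl
    · exact Or.inl ((GaugeGroup.dist1_nonneg _).trans (hδ₁ l.1 (hmem l (by simp)).1 l.2.1 (hmem l (by simp)).2))
  have hlenR : (links.length : ℝ) ≤ ((3 * (P.d * ((P.L - 1) / 2)) + 5 : ℕ) : ℝ) := by exact_mod_cast hlen
  refine ⟨_, g, hend, hl.trans (Nat.mul_le_mul_right _ hlen), hH.trans (mul_le_mul_of_nonneg_right hlenR hθJ0), hg.trans ?_⟩
  rcases hδ0 with h0 | hnil
  · exact mul_le_mul_of_nonneg_right hlenR h0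
  · subst hnil
    simp only [List.map_nil, List.flatten_nil, walkEnd] at hend
    exact absurd hend hne

/-- ★★ **THE HUB LETTERS (H1), (H2) OF `T4RootTransporterHubs` AT THE RECORD's `𝐁_k(Z)`** (same data; `0 ≤ δ₁`).  With the HUB of a site := the centre `ι_J(B^J x)` of its `Γ`-level block
(`J` the unique level with `B^J x ∈ 𝐁_k(Z)_J`), packaged as `∃ hub`: (H1) every `x ∈ Ω₁(Z)` has a transporter datum `root x ⇝ hub x` with budgets `(m₁·L^k, m₁·θ_k, m₁·δ₁)`,
`m₁ = d·(L−1)∕2 + 2` (`N12BjRootChains.exists_chain_root_centre`); (H2) every fine bond with both ends in `Ω₁(Z)` has one `hub b₋ ⇝ hub b₊` with budgets `(m₂·L^k, m₂·θ_k, m₂·δ₁)`,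
`m₂ = d·(L−1)∕2 + 1` (`exists_chain_centre_centre`). [cite: Balaban1985Variational, (3)–(4) p.278, (16)–(18) p.280; Balaban1985Averaging, (19)–(20) p.21; Balaban1988Convergent, (2.13) pp.256–257] -/
theorem hubLetters_Bj (hk : k ≤ P.m + P.K) (hk1 : 1 ≤ k) (hM2 : 2 ≤ M₁) (hdiv : side P.L M₁ k ∣ P.sitesPerDir 0) (root : Site P 0 → Site P 0)
    (hcentre : ∀ (z : Site P 0) (J : ℕ), iterBlockOf J z ∈ (Bj M₁ Z k : DetSet P) J →
      ((1 ≤ J ∧ ∃ c ∈ bondsOf ((Bj M₁ Z k : DetSet P) (J - 1)), (iterBlockOf (J - 1) z = c.src ∨ iterBlockOf (J - 1) z = c.tgt)) ∧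
          root z = embIter (J - 1) (iterBlockOf (J - 1) z)) ∨
      (¬ (1 ≤ J ∧ ∃ c ∈ bondsOf ((Bj M₁ Z k : DetSet P) (J - 1)), (iterBlockOf (J - 1) z = c.src ∨ iterBlockOf (J - 1) z = c.tgt)) ∧
          root z = embIter J (iterBlockOf J z)))
    (ℰ : LoopAverage G) (U : GaugeField P 0 G) (κ θ : ℕ → ℝ) (hθ0 : 0 ≤ θ 0) (hθ : ∀ i, κ i + P.L * θ i ≤ θ (i + 1)) (hθk : ∀ i ≤ k, θ i ≤ θ k)
    (hκ : ∀ i ≤ k, ∀ c ∈ bondsOf ((Bj M₁ Z k : DetSet P) i), ∀ i' < i, ∀ c' : PBond P (i' + 1), c'.dir = c.dir →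
      (∃ t < P.L ^ i, embIter (i' + 1) c'.src = (fun z : Site P 0 => z.shift c.dir)^[t] (embIter i c.src)) →
      dist1 (corr ℰ (Averaging.iter (fun i => blockAvg (P := P) (j := i) ℰ) i' U) c') ≤ κ i')
    {δ₁ : ℝ} (hδ0 : 0 ≤ δ₁) (hδ₁ : ∀ i ≤ k, ∀ c ∈ bondsOf ((Bj M₁ Z k : DetSet P) i), dist1 (Averaging.iter (fun i => blockAvg (P := P) (j := i) ℰ) i U c) ≤ δ₁) :
    ∃ hub : Site P 0 → Site P 0,
      (∀ (x : Site P 0) (J : ℕ), iterBlockOf J x ∈ (Bj M₁ Z k : DetSet P) J → hub x = embIter J (iterBlockOf J x)) ∧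
      (∀ x ∈ maxDomT M₁ Z 1, ∃ (Ωw : List (Letter P.d)) (g : G), walkEnd (root x) Ωw = hub x ∧ Ωw.length ≤ (P.d * ((P.L - 1) / 2) + 2) * P.L ^ k ∧
        dist1 (holAt U (walk (root x) Ωw) * g⁻¹) ≤ ((P.d * ((P.L - 1) / 2) + 2 : ℕ) : ℝ) * θ k ∧ dist1 g ≤ ((P.d * ((P.L - 1) / 2) + 2 : ℕ) : ℝ) * δ₁) ∧
      (∀ b : PBond P 0, b.src ∈ maxDomT M₁ Z 1 → b.tgt ∈ maxDomT M₁ Z 1 →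
        ∃ (Ωw : List (Letter P.d)) (g : G), walkEnd (hub b.src) Ωw = hub b.tgt ∧ Ωw.length ≤ (P.d * ((P.L - 1) / 2) + 1) * P.L ^ k ∧
          dist1 (holAt U (walk (hub b.src) Ωw) * g⁻¹) ≤ ((P.d * ((P.L - 1) / 2) + 1 : ℕ) : ℝ) * θ k ∧ dist1 g ≤ ((P.d * ((P.L - 1) / 2) + 1 : ℕ) : ℝ) * δ₁) := by
  classical
  have hM : 1 ≤ M₁ := by omega
  have hcov := hcov_Bj hM hk1 hk hdiv (Z := Z)
  have hθk0 : 0 ≤ θ k := hθ0.trans (hθk 0 (Nat.zero_le k))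
  -- the hub: the centre of the `Γ`-level block (the level is unique)
  refine ⟨fun x => embIter (Classical.choose (hcov x)) (iterBlockOf (Classical.choose (hcov x)) x), fun x J hJ => ?_, fun x hx => ?_, fun b hbs hbt => ?_⟩
  · have hspec := (Classical.choose_spec (hcov x)).2
    have hJJ : Classical.choose (hcov x) = J := N12BjCollarRoots.eq_of_iterBlockOf_mem_Bj hM hdiv hk hspec hJ
    subst hJJ
    rfl
  · set J := Classical.choose (hcov x)
    have hJ : iterBlockOf J x ∈ (Bj M₁ Z k : DetSet P) J := (Classical.choose_spec (hcov x)).2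
    have hJ1 : 1 ≤ J := by
      by_contra h
      have hJ0 : J = 0 := by omega
      rw [hJ0, Bj_zero (by omega)] at hJ
      exact hJ hx
    obtain ⟨⟨links, hlen, hmem, hend, hcons⟩, -⟩ := exists_chain_root_centre hM2 hdiv hk hJ1 hJ root (hcentre x J hJ)
    obtain ⟨g, hH, hg, hl⟩ := transporter_of_links ℰ U κ θ hθ0 hθ hθk (Bj M₁ Z k) hκ hδ₁ (root x) links hmem (fun l hl => (hmem l hl).1) hcons
    have hlenR : (links.length : ℝ) ≤ ((P.d * ((P.L - 1) / 2) + 2 : ℕ) : ℝ) := by exact_mod_cast hlen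
    exact ⟨_, g, hend, hl.trans (Nat.mul_le_mul_right _ hlen), hH.trans (mul_le_mul_of_nonneg_right hlenR hθk0), hg.trans (mul_le_mul_of_nonneg_right hlenR hδ0)⟩
  · set J := Classical.choose (hcov b.src)
    have hJ : iterBlockOf J b.src ∈ (Bj M₁ Z k : DetSet P) J := (Classical.choose_spec (hcov b.src)).2
    set J' := Classical.choose (hcov b.tgt)
    have hJ' : iterBlockOf J' b.tgt ∈ (Bj M₁ Z k : DetSet P) J' := (Classical.choose_spec (hcov b.tgt)).2
    have hJ1 : 1 ≤ J := by
      by_contra h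
      have hJ0 : J = 0 := by omega
      rw [hJ0, Bj_zero (by omega)] at hJ
      exact hJ hbs
    obtain ⟨links, hlen, hmem, hend, hcons⟩ := exists_chain_centre_centre hM2 hdiv hk b hJ1 hJ hJ'
    obtain ⟨g, hH, hg, hl⟩ := transporter_of_links ℰ U κ θ hθ0 hθ hθk (Bj M₁ Z k) hκ hδ₁ _ links hmem (fun l hl => (hmem l hl).1) hcons
    have hlenR : (links.length : ℝ) ≤ ((P.d * ((P.L - 1) / 2) + 1 : ℕ) : ℝ) := by exact_mod_cast hlen
    exact ⟨_, g, hend, hl.trans (Nat.mul_le_mul_right _ hlen), hH.trans (mul_le_mul_of_nonneg_right hlenR hθk0), hg.trans (mul_le_mul_of_nonneg_right hlenR hδ0)⟩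

end Record

end Summit.QuantumFields.YangMills.BalabanUVNodes.N12RootTransporterBj

end
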